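import Mathlib
import Literature.MathematicalPhysics.QuantumFieldTheory.Balaban1983to89.B6ModifiedPrescription270Torus
import Literature.MathematicalPhysics.QuantumFieldTheory.Balaban1983to89.B6Prop23DomainInput

/-!
# `Balaban1983to89.B6Expansion286ModifiedTorus` — T. Bałaban, *Propagators and renormalization transformations for lattice gauge theories. II*,
Commun. Math. Phys. **96** (1984) 223–250 [Balaban1984PropagatorsII]: **the p. 238 change-of-domain estimate and Proposition 2.3's expansion
(2.82)–(2.87) for the GENUINE one-scale operator `Q′_KG′_K²Q′_K*` WITH THE MODIFIED PRESCRIPTION OF (2.70)** — `C_□ = ((Q′G′(□̃)²Q′*)↾□)⁻¹`,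
`G′(□̃)` the Green's function of the cube `□̃` identified with a torus (p. 238) — ALL FOUR FAMILIES of (2.82) present, the change-of-domain
family bounded by the p. 238 estimate *"the operator with G′(□̃)² − G′² is small and an estimate has the factor exp(−δ₀M)"* proved here
(`hdom_modified`): (2.85) `|R(y, y′)| ≤ (K/M)e^{−δ₁|y−y′|₁}`, the row sums of `|R|` are `≤ ½`, **(2.86)** the Neumann series `Σ_n CRⁿ`
converges to `(Q′_KG′_K²Q′_K*)⁻¹`, and (2.87).

statement-level skeleton of published theorems with citation tags; proofs where landed; nothing here is a claim about the Yang–Mills mass gap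

Phase-2 PROOF SEAT p01 (gen 8) of the cell `lit-balaban` (HOME `run/shared/lean/pub/lit-balaban/`), free-target protocol G.5-34(d), own lane;
file 8 (the change-of-domain input and the assembly) of the programme «the MODIFIED prescription of (2.70) with `G′(□̃)` on the torus `T_□̃`
and the p. 238 change-of-domain sentence, genuine» (files 1–7: `…B6TorusWindowChart`, `…B6TorusCutoffChi`, `…B6Commutator244TowerTorus`,
`…B6TorusTransplant`, `…B6TransplantMajorants`, `…B6TorusFarCorrection`, `…B6ModifiedPrescription270Torus`).  Sources read as page images:
`run/shared/lean/pub/pub-balaban/b2b-balaban-ref1/pages/1984-cmp96-propagators-rt-II/1984-cmp96-propagators-rt-II-p013-x2.png` (p. 235),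
`…-p015-x2.png` (p. 237), `…-p016-x2.png` (p. 238); journal page = PDF page + 222.

THE PRINTED TEXT (verbatim from the text layer of p. 237–238 [PDF 15–16]; displays transcribed by us in brackets).  (2.82) p. 237, third
line: [*+ Σ_{□⊂𝒟} □(Q′G′(□̃)²Q′* − Q′G′²Q′*)h_□C_□h_□*].  p. 238: *"so for M large enough the norm is small. Similar inequalities hold for
kernels of the other operators forming R, for example the operator with G′(□̃)² − G′² is small and an estimate has the factor e^{−δ₀M}
because of the usual estimate of the type (1.12) [3] connected with a change of a domain. This estimate follows from the random walk
representations (2.50) for the operators G′, G′(□̃). An estimate of the terms with the commutator is even simpler and gives a factor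
O(M⁻¹). Now we can estimate the norm of R either using the estimates of the type (2.84), or using an estimate of the kernel R(y, y″) of
the operator R following from all the partial estimates of the type (2.83). It can be written as"* [(2.85): *|R(y, y′)| ≤
O(M⁻¹)exp(−δ₁d(y, y′))(L^{j′}η)^{−d}, y ∈ Λ_j, y′ ∈ Λ_{j′}*] *"and by Lemma 2.1 we get Proposition 2.3. An inverse of the operator Q′G′²Q′*
is given by the convergent expansion"* [(2.86): *(Q′G′²Q′*)⁻¹ = C(I − R)⁻¹ = Σ_{n=0}^∞ CRⁿ*] *"and it satisfies the estimate"* [(2.87):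
*|(Q′G′²Q′*)⁻¹(y, y′)| ≤ O(1)(L^jη)^{−d−4}exp(−δ₂d(y, y′)), y ∈ Λ_j, y′ ∈ Λ_{j′}*]; p. 235 [PDF 13]: *"We change this prescription a
little bit; we take a second cube □̃ containing □ in the middle and of the size 4M and we take an inverse of the operator (Q′G′(□̃)²Q′*)↾□
instead of (Q′G′²Q′*)↾□. Let us define"* [(2.70): *C_□ = ((Q′G′(□̃)²Q′*)↾□)⁻¹, C = Σ_□ h_□C_□h_□*].

WHAT THIS FILE PROVES (kernel-checked, 0 sorry, axioms standard).
* §1 the dictionary `Q′_K = avgOp blk L^{−Kd}`, `Q′_K* = pullOp blk` (`avgOp_eq_Qk_mulVec`, `pullOp_eq_Qks_mulVec`), `kerOp 1 ((Q′MQ′*)(·,·)) =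
  Q′∘M∘Q′*` (`kerOp_entries_eq`), the normalisation `Σ_{B(y)}L^{−Kd} = 1`.
* §2 **`hdom_modified`** — THE p. 238 CHANGE-OF-DOMAIN ESTIMATE for the genuine modified prescription, i.e. the hypothesis `hdom` of the
  cell's `B6Prop23Assembled.prop23_assembled`, NON-VOID (the third line of (2.82) is present: `X̃_□ ≠ X`), as a theorem: there are `δ_G > 0`,
  `B_D ≥ 0` (functions of `d, L, a, m²`) such that for every member `i`, every window exponent `m′` with `ChartHyps i.P i.Mb m′` and the
  located size condition `L²e^{−(δ_G/4)RM} ≤ 1`, every cube `k` and all sites `y, y″`: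
  `|□_k(y)·(X̃_k(y,y″) − (Q′G′²Q′*)(y,y″))·h_k(y″)| ≤ B_D·e^{−(δ_G/48)M}·e^{−(δ_G/24)|y−y″|₁}`, `X̃_k = (Q′G′(□̃_k)²Q′*)↾□_k` the honest
  transplanted object (`B6ModifiedPrescription270Torus.Xloc`).  Route: `X̃_k − X = (X̃_k − Q′G_w²Q′*) + (Q′G_w²Q′* − X)`; the first
  difference is the far term (`B6TorusFarCorrection.abs_qggqK_iotaK_sub_Xw_le`, depth `(H − 2M − 2)/2 ≥ M`), the second is
  `B6Prop23DomainInput.hdom_of_line3` with ALL its located inputs discharged: (2.67) majorants of `G′` and `G′(□̃)`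
  (`B6Commutator244TowerTorus.hasMajorant_comm_G`, `B6TransplantMajorants.hasMajorant_Gw`), the zone majorants of `K(χ)G′`, `K(χ)G′(□̃)`
  (`hasMajorant_comm_G`, `hasMajorant_comm_Gw`), the cut algebra (`B6TorusTransplant.cutHyp_left_Gw/right_Gw`, `Gop_mul_Dop`), the cut-off
  plateau (`chi_eq_one_of_inCube`), the depth of `□` below the zone (`depth_cube_zone`, `M₀ = (M − 1)/2`), the averaging pair and (2.60)/(2.61)
  on one scale.
* §3 the dictionary matrices ↔ census operators (one scale, weights 1).
* §4 **`expansion286_modifiedTorus`**: for `d ≥ 1`, odd `L > 1`, `a > 0`, `m² ≥ 0` there are `M₀, δ₁, K, B > 0` such that for every member `i`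
  of the one-scale family (`B6Prop22OneScaleTorus.Index d L`) and every window exponent `m′` with `ChartHyps i.P i.Mb m′` (`M ≥ 2`,
  `L^{m′} ≥ 5M + 5`, `m′ ≤ m`), `R ≥ 1`, `M ≥ M₀`, `M ∣ N_K`, `2M ≤ N_K`: the modified `C = Σ h_□C_□h_□`, `R`
  (`B6ModifiedPrescription270Torus.CappT/RrwT`) satisfy (2.85), row sums `≤ ½`, the CONVERGENT (2.86) `HasSum (C·Rⁿ) (Q′G′²Q′*)⁻¹` with
  truncation error `≤ B·2^{−N}`, and (2.87).  The located inputs of `prop23_assembled` are all discharged on genuine objects: the cover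
  (`B6CoverTorus`), (2.68) for `X` and `X̃_□` (`ineq268_oneScaleTorus`, `abs_Xloc_le`), the change of domain (`hdom_modified`, `c₃ = δ_G/48`),
  (2.81) (`ineq281_modified`), (2.70) (`locOp_mul_ClocTMat_mul_Hmat`); `members_exist_modified`: admissible members exist for every `K ≥ 1`
  and every threshold (entrywise sums: `B6Expansion286TowerTorus.hasSum_entry_of_hasSum`).

HONEST SCOPE ∕ NOT CLAIMED.  Periodic `G′(□̃)` on a window of side `2L^{m′}` (declared reading of *"identify it with a torus"*; the print's `□̃`
is of size `4M` with unspecified boundary conditions); rates/constants are the certificate's (`δ_G/48`, `δ_G/24`; `δ_G` = the (2.67) rate of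
`…B6Prop22OneScaleTorus`), not the printed `δ₀`; one scale, scalar model, constants existential (functions of `d, L, a, m²`).  Value = the
printed construction of Proposition 2.3, modified prescription and change-of-domain estimate included, run end to end on genuine operators;
NOT summit progress.
-/

namespace Literature.MathematicalPhysics.QuantumFieldTheory.Balaban1983to89.B6Expansion286ModifiedTorus

open Finset Matrix
open B4Sect5Torus (IsPseudoDist)
open B1RG242Torus (tower Qk Qks)
open B5Ineq137Torus (blk)
open B6Prop22OneScaleTorus (T1 oneScaleGeo Index oneScaleGeo_len)
open B6Lemma21TowerTorus (T1_triangle T1_symm T1_nonneg ineq260_oneScaleGeo)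
open B6QGGQInvTowerTorus (wQ wQ_pos qggqK T1_isPseudoDist T1_self)
open B6CoverTorus (CIdx hcov InCube cubeInd cubeInd_eq_one cubeInd_eq_zero inCube_of_hcov_ne_zero cubeInd_zero_or_one abs_hcov_le_one)
open B6RandomWalk (HasMajorant BlockSupp hasMajorant_mono)
open B6RandomWalkHom (HasMajorantHom)
open B6DomainChange (Profile)
open B6DomainMajorant (Ctot Ctot_nonneg)
open B6DomainMajorantSandwich (avgOp pullOp avgOp_apply pullOp_apply hasMajorantHom_avgOp hasMajorantHom_pullOp mulOp_comp_avgOp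
  pullOp_comp_mulOp)
open B6Expansion282 (kerOp kerOp_apply)
open B6Prop23DomainInput (hdom_of_line3 mulOp_eq_mulOp abs_le_one_of_zero_or_one)
open B6TorusWindowChart B6TorusCutoffChi B6TorusTransplant B6TransplantMajorants B6TorusFarCorrection B6ModifiedPrescription270Torus
open B6Commutator244TowerTorus (Dop Gop Gop_mul_Dop Dop_mul_Gop theta0 theta0_pos hasMajorant_comm_G)
open B6Lemma21TowerTorus (T1_triangle T1_symm T1_nonneg triangle254_oneScaleGeo sum_exp_T1_le)
open B6QGGQInvTowerTorus (qggqK T1_isPseudoDist T1_self cinvK_mul)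
open B6Ineq268OneScaleTorus (ineq268_oneScaleTorus)
open B6Expansion282 (mulOp kerOp locOp Cglued R282 PartitionSq mulOp_apply kerOp_apply)
open B6Prop23Chain (mat mat_kerOp smallness_of_M_large)
open B6Prop23Assembled (K285 theta285 prop23_assembled mat_R_abs_le theta285_le)
open B6Lemma21Repaired (Ineq261With Ineq263With ineq263With_of_261With)
open B6CoverTorus (CIdx hcov InCube cubeInd cubeInd_zero_or_one cubeInd_eq_one cubeInd_eq_zero cubeInd_mul_hcov inCube_of_hcov_ne_zero
  sum_hcov_sq card_filter_hcov_ne_zero_le abs_hcov_sub_le gap_of_cubeInd_eq_zero abs_hcov_le_one hcov_nonneg)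
open B6Expansion286TowerTorus (Cube Pmat Hmat Pmat_mul_Hmat partitionSq_Hmat hasSum_neumann K285L K285_oneScaleGeo)
open B6ModifiedPrescription270Torus

noncomputable section


variable {P : Params}

/-! ## §1  Dictionary: `Q′_K`, `Q′_K*` as the averaging pair of the line-3 chain; kernels with unit weights -/

/-- `Q′_K = avgOp blk (L^{−Kd})`. [cite: Balaban1984PropagatorsII, (2.14)–(2.15) p.225; bookkeeping] -/
theorem avgOp_eq_Qk_mulVec {Mb R : ℕ} (μ : Site P 0 → ℝ) (y : Site P P.K) :
    avgOp (g := oneScaleGeo P Mb R) (blk P P.K) (fun _ => wQ P P.K) μ y = (Qk P P.K *ᵥ μ) y := by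
  rw [avgOp_apply, Qk_mulVec_eq (Nat.le_add_left _ _), Finset.sum_filter, Finset.mul_sum]
  refine Finset.sum_congr rfl fun x _ => ?_
  split_ifs <;> simp

/-- `Q′_K* = pullOp blk`. [cite: Balaban1984PropagatorsII, (2.15) p.225; bookkeeping] -/
theorem pullOp_eq_Qks_mulVec {Mb R : ℕ} (ω : Site P P.K → ℝ) (x : Site P 0) :
    pullOp (g := oneScaleGeo P Mb R) (blk P P.K) ω x = (Qks P P.K *ᵥ ω) x := by
  rw [pullOp_apply]
  simp only [Matrix.mulVec, dotProduct, Qks_apply (Nat.le_add_left _ _), ite_mul, one_mul, zero_mul, Finset.sum_ite_eq,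
    Finset.mem_univ, if_true]

/-- the normalisation `Σ_{x∈B(y)}L^{−Kd} = 1 ≤ 1`. [cite: Balaban1982Higgs1, (2.11) p.609; bookkeeping] -/
theorem sum_wQ_le_one (y : Site P P.K) : (∑ x : Site P 0, if blk P P.K x = y then wQ P P.K else 0) ≤ 1 := by
  rw [← Finset.sum_filter, Finset.sum_const, nsmul_eq_mul, mul_comm, wQ_mul_card_blk]

/-- **kernels with unit weights**: `kerOp 1 ((Q′MQ′*)(·,·)) = Q′∘M∘Q′*` for every matrix `M` on `L²(T_η)`.
[cite: Balaban1984PropagatorsII, (2.69) p.235; bookkeeping] -/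
theorem kerOp_entries_eq {Mb R : ℕ} {d : ℕ} (M : Matrix (Site P 0) (Site P 0) ℝ) :
    kerOp (fun z => (oneScaleGeo P Mb R).len z ^ d) (fun y y'' => (Qk P P.K * M * Qks P P.K) y y'') =
      avgOp (g := oneScaleGeo P Mb R) (blk P P.K) (fun _ => wQ P P.K) ∘ₗ Matrix.toLin' M ∘ₗ
        pullOp (g := oneScaleGeo P Mb R) (blk P P.K) := by
  refine LinearMap.ext fun μ => funext fun y => ?_
  have hpull : pullOp (g := oneScaleGeo P Mb R) (blk P P.K) μ = Qks P P.K *ᵥ μ := funext fun x => pullOp_eq_Qks_mulVec μ x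
  rw [kerOp_apply, LinearMap.comp_apply, LinearMap.comp_apply, avgOp_eq_Qk_mulVec, Matrix.toLin'_apply, hpull, Matrix.mulVec_mulVec,
    Matrix.mulVec_mulVec]
  simp only [oneScaleGeo_len, one_pow, one_mul]
  rfl

/-! ## §2  The change-of-domain input for the genuine modified prescription -/

/-- **THE p. 238 CHANGE-OF-DOMAIN ESTIMATE FOR THE GENUINE MODIFIED PRESCRIPTION** (the hypothesis `hdom` of
`B6Prop23Assembled.prop23_assembled`, non-void, as a theorem).  There are `δ_G > 0` (the (2.67) rate of the one-scale family) and `B_D ≥ 0` such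
that for every member `i`, every window exponent `m′` with the chart hypotheses and the located size condition `L²e^{−(δ_G/4)RM} ≤ 1`,
every cube `k` of the cover and all unit sites `y, y″`:
`|□_k(y)·(1·(X̃_k(y, y″) − (Q′G′²Q′*)(y, y″)))·h_k(y″)| ≤ B_D·e^{−(δ_G/48)M}·1·e^{−½(δ_G/12)|y − y″|₁}` — *"the operator with G′(□̃)² − G′² is
small and an estimate has the factor exp(−δ₀M)"*, at the certificate's rate.
[cite: Balaban1984PropagatorsII, p.238 before (2.85), (2.82) line 3 p.237] -/
theorem hdom_modified (d L : ℕ) (hd : 1 ≤ d) (hL : Odd L ∧ 1 < L) {a : ℝ} (ha : 0 < a) {msq : ℝ} (hmsq : 0 ≤ msq) :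
    ∃ δG BD : ℝ, 0 < δG ∧ 0 ≤ BD ∧ ∀ (i : Index d L) (m' : ℕ), ChartHyps i.P i.Mb m' →
      (i.P.L : ℝ) ^ 2 * Real.exp (-(δG / 4 * ((i.R : ℝ) * (i.Mb : ℝ)))) ≤ 1 →
      ∀ (k : CIdx i.P i.P.K i.Mb) (y y'' : Site i.P i.P.K),
        |cubeInd i.P i.P.K i.Mb k y *
            ((oneScaleGeo i.P i.Mb i.R).len y'' ^ d * (Xloc i.P i.Mb m' a msq k y y'' - qggqK i.P a msq y y'')) *
          hcov i.P i.P.K i.Mb k y''| ≤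
        BD * Real.exp (-(δG / 48 * (i.Mb : ℝ))) * (oneScaleGeo i.P i.Mb i.R).len y ^ 4 *
          Real.exp (-(1 / 2 * (δG / 12) * T1 i.P i.P.K y y'')) := by
  obtain ⟨δG, C, hδG, hC, hfam⟩ := hasMajorant_comm_G d L hd hL ha hmsq
  -- the constant B_D = L²·C_tot(c₀(·,1)^d, C, θ₀, δ_G/4) + C²·c₀(δ_G/6, 1)^d, θ₀ = theta0 d a C δ_G
  have hθ := theta0_pos d ha.le hC.le δG
  have hK3 : 0 ≤ B6.c0 (δG / 6) 1 ^ d := pow_nonneg (B6RandomWalk.c0_nonneg _ 1) d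
  have hCt : 0 ≤ Ctot (fun t => B6.c0 t 1 ^ d) C (theta0 d a C δG) (δG / 4) :=
    Ctot_nonneg (fun t _ => pow_nonneg (B6RandomWalk.c0_nonneg t 1) d) hC.le hθ.le (by positivity)
  set BD : ℝ := (L : ℝ) ^ 2 * Ctot (fun t => B6.c0 t 1 ^ d) C (theta0 d a C δG) (δG / 4) + C * C * (B6.c0 (δG / 6) 1 ^ d) with hBDdef
  have hBD : 0 ≤ BD := by positivity
  refine ⟨δG, BD, hδG, hBD, fun i m' hc hsize k y y'' => ?_⟩
  have hs := sizes hc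
  have hMb1 : (1 : ℝ) ≤ i.Mb := by exact_mod_cast hs.1
  have hlen : ∀ z : (oneScaleGeo i.P i.Mb i.R).Site, (oneScaleGeo i.P i.Mb i.R).len z = 1 := fun z => oneScaleGeo_len i.P i.Mb i.R z
  have hRHS : 0 ≤ BD * Real.exp (-(δG / 48 * (i.Mb : ℝ))) * (oneScaleGeo i.P i.Mb i.R).len y ^ 4 *
      Real.exp (-(1 / 2 * (δG / 12) * T1 i.P i.P.K y y'')) := by
    rw [hlen]; positivity
  -- trivial cases: y ∉ □ or y″ ∉ supp h
  by_cases hy : InCube i.P i.P.K i.Mb k y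
  swap
  · rw [cubeInd_eq_zero hy, zero_mul, zero_mul, abs_zero]; exact hRHS
  by_cases hy'' : InCube i.P i.P.K i.Mb k y''
  swap
  · have h0 : hcov i.P i.P.K i.Mb k y'' = 0 := by by_contra hne; exact hy'' (inCube_of_hcov_ne_zero hs.1 hne)
    rw [h0, mul_zero, abs_zero]; exact hRHS
  -- the chart data of the cube
  have hyV := mem_Vk_of_inCube hc hy
  have hy''V := mem_Vk_of_inCube hc hy''
  have hyabs := (inCube_iff_abs_le hc k y).mp hy
  have hVdeep : ∀ z ∈ Vk i.P i.Mb m' k, DeepBlk i.P (cc i.P i.Mb m' k) m' z := fun z hz => deep_of_mem_Vk hc hz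
  have hVhalf : ∀ z ∈ Vk i.P i.Mb m' k, ∀ z' ∈ Vk i.P i.Mb m' k, ∀ μ,
      2 * |(woff i.P i.P.K (cc i.P i.Mb m' k) z μ : ℤ) - (woff i.P i.P.K (cc i.P i.Mb m' k) z' μ : ℤ)| ≤
        (smallVol i.P m').sitesPerDir i.P.K :=
    fun z hz z' hz' μ => half_of_mem_Vk hz hz' μ
  -- the family data at the member and at the small member
  obtain ⟨hGi, hdGi, hcommi⟩ := hfam i
  obtain ⟨hGi', hdGi', -⟩ := hfam (smallIdx i m')
  ---------------------------------------------------------------- the far term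
  have hfar := abs_qggqK_iotaK_sub_Xw_le (a := a) (msq := msq) hc.m'_le hVdeep hC.le (half_pos hδG) hGi' hyV hy''V
    (D₀ := ((Hh i.P m' : ℝ) - 2 * i.Mb - 2) / 2) (fun u hu => ⟨depth_cube_far hc hyabs hu,
      depth_cube_far hc ((inCube_iff_abs_le hc k y'').mp hy'') hu⟩)
  ---------------------------------------------------------------- the line-3 term
  have hρ : IsPseudoDist (oneScaleGeo i.P i.Mb i.R).dist := T1_isPseudoDist i.P i.P.K
  have h260 : B6RandomWalk.Ineq260 (oneScaleGeo i.P i.Mb i.R) (δG / 2) (1 / 2) := ineq260_oneScaleGeo i.P i.Mb i.R (by positivity)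
  have hKpr : ∀ t : ℝ, 0 < t → 0 ≤ (fun t => B6.c0 t 1 ^ d) t := fun t _ => pow_nonneg (B6RandomWalk.c0_nonneg t 1) d
  have hPr : Profile (oneScaleGeo i.P i.Mb i.R).dist (fun z : (oneScaleGeo i.P i.Mb i.R).Site => z) (fun t => B6.c0 t 1 ^ d) := by
    have h := profile_T1 i.P i.P.K
    rw [i.hPd] at h
    exact h
  have hRM : 0 ≤ (oneScaleGeo i.P i.Mb i.R).R * (oneScaleGeo i.P i.Mb i.R).M := by
    show (0 : ℝ) ≤ (i.R : ℝ) * (i.Mb : ℝ); positivity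
  have hgL : 1 ≤ (oneScaleGeo i.P i.Mb i.R).L := by show (1 : ℝ) ≤ (i.P.L : ℝ); exact_mod_cast i.P.hL.2.le
  have hsize' : (oneScaleGeo i.P i.Mb i.R).L ^ 2 *
      Real.exp (-(1 / 2 * (δG / 2) * ((oneScaleGeo i.P i.Mb i.R).R * (oneScaleGeo i.P i.Mb i.R).M))) ≤ 1 := by
    show ((i.P.L : ℕ) : ℝ) ^ 2 * Real.exp (-(1 / 2 * (δG / 2) * ((i.R : ℝ) * (i.Mb : ℝ)))) ≤ 1
    rw [show 1 / 2 * (δG / 2) = δG / 4 by ring]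
    exact hsize
  have hN : (Finset.univ \ Core i.P (cc i.P i.Mb m' k) (Hh i.P m') i.Mb).Nonempty := zone_nonempty hc k
  have hχ1 : ∀ x, |chiCut i.P (cc i.P i.Mb m' k) (Hh i.P m') i.Mb x| ≤ 1 := fun x => abs_chiCut_le_one _ _ _ x
  have hpf1 : ∀ z, |cubeInd i.P i.P.K i.Mb k z| ≤ 1 := abs_le_one_of_zero_or_one (cubeInd_zero_or_one k)
  have hh1 : ∀ z, |hcov i.P i.P.K i.Mb k z| ≤ 1 := fun z => abs_hcov_le_one k z
  have hpfχ : ∀ x, cubeInd i.P i.P.K i.Mb k (blk i.P i.P.K x) * chiCut i.P (cc i.P i.Mb m' k) (Hh i.P m') i.Mb x =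
      cubeInd i.P i.P.K i.Mb k (blk i.P i.P.K x) := by
    intro x
    by_cases hx : InCube i.P i.P.K i.Mb k (blk i.P i.P.K x)
    · rw [(chi_eq_one_of_inCube hc hx).1, mul_one]
    · rw [cubeInd_eq_zero hx, zero_mul]
  have hhχ : ∀ x, chiCut i.P (cc i.P i.Mb m' k) (Hh i.P m') i.Mb x * hcov i.P i.P.K i.Mb k (blk i.P i.P.K x) =
      hcov i.P i.P.K i.Mb k (blk i.P i.P.K x) := by
    intro x
    by_cases hx : hcov i.P i.P.K i.Mb k (blk i.P i.P.K x) = 0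
    · rw [hx, mul_zero]
    · rw [(chi_eq_one_of_inCube hc (inCube_of_hcov_ne_zero hs.1 hx)).1, one_mul]
  have hχN : ∀ x, blk i.P i.P.K x ∉ Finset.univ \ Core i.P (cc i.P i.Mb m' k) (Hh i.P m') i.Mb →
      chiCut i.P (cc i.P i.Mb m' k) (Hh i.P m') i.Mb x = 1 := by
    intro x hx
    have hx' : blk i.P i.P.K x ∈ Core i.P (cc i.P i.Mb m' k) (Hh i.P m') i.Mb := by
      by_contra hne; exact hx (Finset.mem_sdiff.mpr ⟨Finset.mem_univ _, hne⟩)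
    exact chi_eq_one_of_mem_Core hc hx'
  have hGD : Gop i.P a msq * Dop i.P a msq = 1 := Gop_mul_Dop ha hmsq i.hK
  have hDG : Dop i.P a msq * Gop i.P a msq = 1 := Dop_mul_Gop ha hmsq i.hK
  have hχV : ∀ x, chiCut i.P (cc i.P i.Mb m' k) (Hh i.P m') i.Mb x ≠ 0 → blk i.P i.P.K x ∈ Vk i.P i.Mb m' k ∧
      ∀ μ, blk i.P i.P.K (x.shift μ) ∈ Vk i.P i.Mb m' k ∧ blk i.P i.P.K (x.unshift μ) ∈ Vk i.P i.Mb m' k := by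
    intro x hx
    refine ⟨chi_support_Vk hc hx _ ?_, fun μ => ⟨chi_support_Vk hc hx _ ?_, chi_support_Vk hc hx _ ?_⟩⟩
    · rw [T1_self]; norm_num
    · exact (T1_blk_shift_le x μ).trans (by norm_num)
    · exact (T1_blk_unshift_le x μ).trans (by norm_num)
  have hχGw : B9Thm37Sum.mulOp (chiCut i.P (cc i.P i.Mb m' k) (Hh i.P m') i.Mb) * Dop i.P a msq *
      Gw i.P (cc i.P i.Mb m' k) m' (Vk i.P i.Mb m' k) a msq = B9Thm37Sum.mulOp (chiCut i.P (cc i.P i.Mb m' k) (Hh i.P m') i.Mb) := by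
    rw [mulOp_eq_mulOp]; exact cutHyp_left_Gw ha hmsq i.hK hc.m'_le hVdeep hχV
  have hGwχ : Gw i.P (cc i.P i.Mb m' k) m' (Vk i.P i.Mb m' k) a msq * Dop i.P a msq *
      B9Thm37Sum.mulOp (chiCut i.P (cc i.P i.Mb m' k) (Hh i.P m') i.Mb) = B9Thm37Sum.mulOp (chiCut i.P (cc i.P i.Mb m' k) (Hh i.P m') i.Mb) := by
    rw [mulOp_eq_mulOp]; exact cutHyp_right_Gw ha hmsq i.hK hc.m'_le hVdeep hχV
  -- majorants, in the chain's kernel shape `B₁·len²·e^{−δd}` (len = 1)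
  have kshape : ∀ u v : Site i.P i.P.K, C * Real.exp (-(δG / 2 * T1 i.P i.P.K u v)) =
      C * (oneScaleGeo i.P i.Mb i.R).len u ^ 2 * Real.exp (-(δG / 2 * (oneScaleGeo i.P i.Mb i.R).dist u v)) := by
    intro u v; rw [hlen, one_pow, mul_one]
  have hG : HasMajorant (g := oneScaleGeo i.P i.Mb i.R) (blk i.P i.P.K) (Gop i.P a msq)
      (fun u v => C * (oneScaleGeo i.P i.Mb i.R).len u ^ 2 * Real.exp (-(δG / 2 * (oneScaleGeo i.P i.Mb i.R).dist u v))) :=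
    hasMajorant_mono (g := oneScaleGeo i.P i.Mb i.R) (blk i.P i.P.K) hGi fun u v => le_of_eq (kshape u v)
  have hGw : HasMajorant (g := oneScaleGeo i.P i.Mb i.R) (blk i.P i.P.K) (Gw i.P (cc i.P i.Mb m' k) m' (Vk i.P i.Mb m' k) a msq)
      (fun u v => C * (oneScaleGeo i.P i.Mb i.R).len u ^ 2 * Real.exp (-(δG / 2 * (oneScaleGeo i.P i.Mb i.R).dist u v))) :=
    hasMajorant_mono (g := oneScaleGeo i.P i.Mb i.R) (blk i.P i.P.K) (hasMajorant_Gw (Mb := i.Mb) (R := i.R) hc.m'_le hVdeep hVhalf hC.le hδG.le hGi')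
      fun u v => le_of_eq (kshape u v)
  have zshape : ∀ u v : Site i.P i.P.K,
      (if u ∈ Finset.univ \ Core i.P (cc i.P i.Mb m' k) (Hh i.P m') i.Mb then theta0 d a C δG / i.Mb else 0) *
          Real.exp (-(δG / 2 * T1 i.P i.P.K u v)) ≤
        (if u ∈ Finset.univ \ Core i.P (cc i.P i.Mb m' k) (Hh i.P m') i.Mb then theta0 d a C δG else 0) *
          Real.exp (-(δG / 2 * (oneScaleGeo i.P i.Mb i.R).dist u v)) := by
    intro u v
    refine mul_le_mul_of_nonneg_right ?_ (Real.exp_pos _).le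
    split_ifs
    · exact div_le_self hθ.le hMb1
    · exact le_rfl
  have hKGw : HasMajorant (g := oneScaleGeo i.P i.Mb i.R) (blk i.P i.P.K) ((B9Thm37Sum.mulOp (chiCut i.P (cc i.P i.Mb m' k) (Hh i.P m') i.Mb) * Dop i.P a msq -
      Dop i.P a msq * B9Thm37Sum.mulOp (chiCut i.P (cc i.P i.Mb m' k) (Hh i.P m') i.Mb)) * Gw i.P (cc i.P i.Mb m' k) m' (Vk i.P i.Mb m' k) a msq)
      (fun u v => (if u ∈ Finset.univ \ Core i.P (cc i.P i.Mb m' k) (Hh i.P m') i.Mb then theta0 d a C δG else 0) *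
        Real.exp (-(δG / 2 * (oneScaleGeo i.P i.Mb i.R).dist u v))) := by
    rw [mulOp_eq_mulOp]
    exact hasMajorant_mono (g := oneScaleGeo i.P i.Mb i.R) (blk i.P i.P.K) (hasMajorant_comm_Gw (Mb := i.Mb) (R := i.R) i.hPd ha i.hK hc.m'_le hVdeep hVhalf hs.1
      hs.2.2.2.1 hs.2.2.2.2 (fun x hx z hz => chi_support_Vk hc hx z hz) hC hδG hGi' hdGi') zshape
  have hKG : HasMajorant (g := oneScaleGeo i.P i.Mb i.R) (blk i.P i.P.K) ((B9Thm37Sum.mulOp (chiCut i.P (cc i.P i.Mb m' k) (Hh i.P m') i.Mb) * Dop i.P a msq -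
      Dop i.P a msq * B9Thm37Sum.mulOp (chiCut i.P (cc i.P i.Mb m' k) (Hh i.P m') i.Mb)) * Gop i.P a msq)
      (fun u v => (if u ∈ Finset.univ \ Core i.P (cc i.P i.Mb m' k) (Hh i.P m') i.Mb then theta0 d a C δG else 0) *
        Real.exp (-(δG / 2 * (oneScaleGeo i.P i.Mb i.R).dist u v))) := by
    rw [mulOp_eq_mulOp]
    exact hasMajorant_mono (g := oneScaleGeo i.P i.Mb i.R) (blk i.P i.P.K) (hcommi (cc i.P i.Mb m' k) (Hh i.P m') i.Mb hs.1 hs.2.2.2.1 hs.2.2.2.2) zshape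
  -- depth of □ and supp h below the zone
  have hpfdeep : ∀ z, cubeInd i.P i.P.K i.Mb k z ≠ 0 → ∀ n ∈ Finset.univ \ Core i.P (cc i.P i.Mb m' k) (Hh i.P m') i.Mb,
      ((i.Mb : ℝ) - 1) / 2 ≤ (oneScaleGeo i.P i.Mb i.R).dist z n := fun z hz n hn =>
    depth_cube_zone hc ((inCube_iff_abs_le hc k z).mp (B6CoverTorus.inCube_of_cubeInd_ne_zero hz)) hn
  have hhdeep : ∀ z, hcov i.P i.P.K i.Mb k z ≠ 0 → ∀ n ∈ Finset.univ \ Core i.P (cc i.P i.Mb m' k) (Hh i.P m') i.Mb,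
      ((i.Mb : ℝ) - 1) / 2 ≤ (oneScaleGeo i.P i.Mb i.R).dist z n := fun z hz n hn =>
    depth_cube_zone hc (abs_le_of_hcov_ne_zero hc hz) hn
  -- the averaging pair
  have hQ := hasMajorantHom_avgOp (g := oneScaleGeo i.P i.Mb i.R) (blk i.P i.P.K) (w := fun _ => wQ i.P i.P.K)
    (fun _ => (wQ_pos i.P i.P.K).le) sum_wQ_le_one
  have hQs := hasMajorantHom_pullOp (g := oneScaleGeo i.P i.Mb i.R) (blk i.P i.P.K)
  have hQ' : HasMajorantHom (g := oneScaleGeo i.P i.Mb i.R) (blk i.P i.P.K) (fun z : (oneScaleGeo i.P i.Mb i.R).Site => z)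
      (avgOp (g := oneScaleGeo i.P i.Mb i.R) (blk i.P i.P.K) (fun _ => wQ i.P i.P.K))
      (fun u v : (oneScaleGeo i.P i.Mb i.R).Site => (1 : ℝ) * (if u = v then (1 : ℝ) else 0)) := by
    intro y₁ μ B hμ v; have h := hQ y₁ μ B hμ v; simp only [one_mul] at h ⊢; exact h
  have hQs' : HasMajorantHom (g := oneScaleGeo i.P i.Mb i.R) (fun z : (oneScaleGeo i.P i.Mb i.R).Site => z) (blk i.P i.P.K)
      (pullOp (g := oneScaleGeo i.P i.Mb i.R) (blk i.P i.P.K))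
      (fun u v : (oneScaleGeo i.P i.Mb i.R).Site => (1 : ℝ) * (if u = v then (1 : ℝ) else 0)) := by
    intro y₁ μ B hμ v; have h := hQs y₁ μ B hμ v; simp only [one_mul] at h ⊢; exact h
  -- the kernels as sandwiches
  have hX : kerOp (fun z => (oneScaleGeo i.P i.Mb i.R).len z ^ d) (fun y y'' => qggqK i.P a msq y y'') =
      avgOp (g := oneScaleGeo i.P i.Mb i.R) (blk i.P i.P.K) (fun _ => wQ i.P i.P.K) ∘ₗ (Gop i.P a msq * Gop i.P a msq) ∘ₗ
        pullOp (g := oneScaleGeo i.P i.Mb i.R) (blk i.P i.P.K) := by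
    have e : (fun y y'' => qggqK i.P a msq y y'') =
        fun y y'' => (Qk i.P i.P.K * ((tower i.P a msq).G i.P.K * (tower i.P a msq).G i.P.K) * Qks i.P i.P.K) y y'' := by
      funext y y''; unfold qggqK; rw [Matrix.mul_assoc (Qk i.P i.P.K)]
    rw [e, kerOp_entries_eq, Gop, Module.End.mul_eq_comp, ← Matrix.toLin'_mul]
  have hXw : kerOp (fun z => (oneScaleGeo i.P i.Mb i.R).len z ^ d)
      (fun y y'' => (Qk i.P i.P.K * GwMat i.P (cc i.P i.Mb m' k) m' (Vk i.P i.Mb m' k) a msq *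
        GwMat i.P (cc i.P i.Mb m' k) m' (Vk i.P i.Mb m' k) a msq * Qks i.P i.P.K) y y'') =
      avgOp (g := oneScaleGeo i.P i.Mb i.R) (blk i.P i.P.K) (fun _ => wQ i.P i.P.K) ∘ₗ
        (Gw i.P (cc i.P i.Mb m' k) m' (Vk i.P i.Mb m' k) a msq * Gw i.P (cc i.P i.Mb m' k) m' (Vk i.P i.Mb m' k) a msq) ∘ₗ
          pullOp (g := oneScaleGeo i.P i.Mb i.R) (blk i.P i.P.K) := by
    have e : (fun y y'' => (Qk i.P i.P.K * GwMat i.P (cc i.P i.Mb m' k) m' (Vk i.P i.Mb m' k) a msq *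
        GwMat i.P (cc i.P i.Mb m' k) m' (Vk i.P i.Mb m' k) a msq * Qks i.P i.P.K) y y'') =
        fun y y'' => (Qk i.P i.P.K * (GwMat i.P (cc i.P i.Mb m' k) m' (Vk i.P i.Mb m' k) a msq *
          GwMat i.P (cc i.P i.Mb m' k) m' (Vk i.P i.Mb m' k) a msq) * Qks i.P i.P.K) y y'' := by
      funext y y''; rw [Matrix.mul_assoc (Qk i.P i.P.K)]
    rw [e, kerOp_entries_eq, Gw, Module.End.mul_eq_comp, ← Matrix.toLin'_mul]
  have hM₀ : δG / 48 * (oneScaleGeo i.P i.Mb i.R).M ≤ (δG / 2 - 1 / 2 * (δG / 2)) / 3 * (((i.Mb : ℝ) - 1) / 2) := by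
    show δG / 48 * (i.Mb : ℝ) ≤ (δG / 2 - 1 / 2 * (δG / 2)) / 3 * (((i.Mb : ℝ) - 1) / 2)
    have h2 : (2 : ℝ) ≤ i.Mb := by exact_mod_cast hc.two_le
    nlinarith
  have hline := hdom_of_line3 (g := oneScaleGeo i.P i.Mb i.R) (X := Site i.P 0) (blk i.P i.P.K) hρ h260 hKpr hPr (by positivity)
    hRM hgL hsize' _ hN (δ := δG / 2) (B₁ := C) (θ := theta0 d a C δG) (by linarith) hC.le hθ.le hχ1 hpf1 hh1 hpfχ hhχ hχN hGD hDG
    hχGw hGwχ hG hGw hKGw hKG hpfdeep hhdeep zero_le_one zero_le_one hQ' hQs'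
    (mulOp_comp_avgOp (g := oneScaleGeo i.P i.Mb i.R) (blk i.P i.P.K) (fun _ => wQ i.P i.P.K) (cubeInd i.P i.P.K i.Mb k))
    (pullOp_comp_mulOp (g := oneScaleGeo i.P i.Mb i.R) (blk i.P i.P.K) (hcov i.P i.P.K i.Mb k)) d hX hXw hM₀ y y''
  ---------------------------------------------------------------- assembling the two terms
  have esplit : Xloc i.P i.Mb m' a msq k y y'' - qggqK i.P a msq y y'' =
      (qggqK (smallVol i.P m') a msq (iotaK i.P (cc i.P i.Mb m' k) m' y) (iotaK i.P (cc i.P i.Mb m' k) m' y'') -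
        (Qk i.P i.P.K * GwMat i.P (cc i.P i.Mb m' k) m' (Vk i.P i.Mb m' k) a msq * GwMat i.P (cc i.P i.Mb m' k) m' (Vk i.P i.Mb m' k) a msq *
          Qks i.P i.P.K) y y'') +
      ((Qk i.P i.P.K * GwMat i.P (cc i.P i.Mb m' k) m' (Vk i.P i.Mb m' k) a msq * GwMat i.P (cc i.P i.Mb m' k) m' (Vk i.P i.Mb m' k) a msq *
          Qks i.P i.P.K) y y'' - qggqK i.P a msq y y'') := by
    rw [Xloc_eq_of_inCube hy hy'']; ring
  rw [esplit, mul_add, mul_add, add_mul]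
  refine (abs_add_le _ _).trans ?_
  have hT := T1_le_T1_iotaK_of_mem_Vk hc hyV hy''V
  have hT0 := T1_nonneg i.P i.P.K y y''
  have hH5 : (5 * (i.Mb : ℝ) + 5) ≤ (Hh i.P m' : ℝ) := by exact_mod_cast hc.H_large
  have hfar' : |cubeInd i.P i.P.K i.Mb k y * ((oneScaleGeo i.P i.Mb i.R).len y'' ^ d *
      (qggqK (smallVol i.P m') a msq (iotaK i.P (cc i.P i.Mb m' k) m' y) (iotaK i.P (cc i.P i.Mb m' k) m' y'') -
        (Qk i.P i.P.K * GwMat i.P (cc i.P i.Mb m' k) m' (Vk i.P i.Mb m' k) a msq * GwMat i.P (cc i.P i.Mb m' k) m' (Vk i.P i.Mb m' k) a msq *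
          Qks i.P i.P.K) y y'')) * hcov i.P i.P.K i.Mb k y''| ≤
      C * C * (B6.c0 (δG / 6) 1 ^ d) * Real.exp (-(δG / 48 * (i.Mb : ℝ))) * (oneScaleGeo i.P i.Mb i.R).len y ^ 4 *
        Real.exp (-(1 / 2 * (δG / 12) * T1 i.P i.P.K y y'')) := by
    rw [abs_mul, abs_mul, abs_mul, hlen, hlen, one_pow, one_pow, abs_one, one_mul, mul_one]
    have h1 : |cubeInd i.P i.P.K i.Mb k y| *
        |qggqK (smallVol i.P m') a msq (iotaK i.P (cc i.P i.Mb m' k) m' y) (iotaK i.P (cc i.P i.Mb m' k) m' y'') -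
          (Qk i.P i.P.K * GwMat i.P (cc i.P i.Mb m' k) m' (Vk i.P i.Mb m' k) a msq * GwMat i.P (cc i.P i.Mb m' k) m' (Vk i.P i.Mb m' k) a msq *
            Qks i.P i.P.K) y y''| * |hcov i.P i.P.K i.Mb k y''| ≤
        1 * |qggqK (smallVol i.P m') a msq (iotaK i.P (cc i.P i.Mb m' k) m' y) (iotaK i.P (cc i.P i.Mb m' k) m' y'') -
          (Qk i.P i.P.K * GwMat i.P (cc i.P i.Mb m' k) m' (Vk i.P i.Mb m' k) a msq * GwMat i.P (cc i.P i.Mb m' k) m' (Vk i.P i.Mb m' k) a msq *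
            Qks i.P i.P.K) y y''| * 1 := by
      gcongr
      · exact hpf1 y
      · exact hh1 y''
    rw [one_mul, mul_one] at h1
    refine h1.trans (hfar.trans ?_)
    rw [i.hPd, show δG / 2 / 3 = δG / 6 by ring]
    have e1 : Real.exp (-(2 * (δG / 6) * (((Hh i.P m' : ℝ) - 2 * i.Mb - 2) / 2))) ≤ Real.exp (-(δG / 48 * (i.Mb : ℝ))) :=
      Real.exp_le_exp.mpr (by nlinarith)
    have e2 : Real.exp (-(δG / 6 * T1 (smallVol i.P m') i.P.K (iotaK i.P (cc i.P i.Mb m' k) m' y) (iotaK i.P (cc i.P i.Mb m' k) m' y''))) ≤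
        Real.exp (-(1 / 2 * (δG / 12) * T1 i.P i.P.K y y'')) := Real.exp_le_exp.mpr (by nlinarith)
    calc C * C * B6.c0 (δG / 6) 1 ^ d * Real.exp (-(2 * (δG / 6) * (((Hh i.P m' : ℝ) - 2 * i.Mb - 2) / 2))) *
          Real.exp (-(δG / 6 * T1 (smallVol i.P m') i.P.K (iotaK i.P (cc i.P i.Mb m' k) m' y) (iotaK i.P (cc i.P i.Mb m' k) m' y'')))
        ≤ C * C * B6.c0 (δG / 6) 1 ^ d * Real.exp (-(δG / 48 * (i.Mb : ℝ))) * Real.exp (-(1 / 2 * (δG / 12) * T1 i.P i.P.K y y'')) := by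
          gcongr
      _ = _ := by rfl
  have hline' : |cubeInd i.P i.P.K i.Mb k y * ((oneScaleGeo i.P i.Mb i.R).len y'' ^ d *
      ((Qk i.P i.P.K * GwMat i.P (cc i.P i.Mb m' k) m' (Vk i.P i.Mb m' k) a msq * GwMat i.P (cc i.P i.Mb m' k) m' (Vk i.P i.Mb m' k) a msq *
          Qks i.P i.P.K) y y'' - qggqK i.P a msq y y'')) * hcov i.P i.P.K i.Mb k y''| ≤
      (L : ℝ) ^ 2 * Ctot (fun t => B6.c0 t 1 ^ d) C (theta0 d a C δG) (δG / 4) * Real.exp (-(δG / 48 * (i.Mb : ℝ))) *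
        (oneScaleGeo i.P i.Mb i.R).len y ^ 4 * Real.exp (-(1 / 2 * (δG / 12) * T1 i.P i.P.K y y'')) := by
    refine hline.trans (le_of_eq ?_)
    rw [show δG / 2 - 1 / 2 * (δG / 2) = δG / 4 by ring, show δG / 4 / 3 = δG / 12 by ring,
      show (oneScaleGeo i.P i.Mb i.R).L = ((i.P.L : ℕ) : ℝ) from rfl, i.hPL]
    show 1 * 1 * ((L : ℝ) ^ 2 * Ctot (fun t => B6.c0 t 1 ^ d) C (theta0 d a C δG) (δG / 4)) * Real.exp (-(δG / 48 * (i.Mb : ℝ))) *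
        (oneScaleGeo i.P i.Mb i.R).len y ^ 4 * Real.exp (-(1 / 2 * (δG / 12) * T1 i.P i.P.K y y'')) = _
    ring
  calc _ ≤ _ := add_le_add hfar' hline'
    _ = BD * Real.exp (-(δG / 48 * (i.Mb : ℝ))) * (oneScaleGeo i.P i.Mb i.R).len y ^ 4 *
        Real.exp (-(1 / 2 * (δG / 12) * T1 i.P i.P.K y y'')) := by
        rw [hBDdef]; ring


/-! ## §3  Dictionary: matrices on `T₁^{(K)}` as the census operators on `L²(𝔅)` (one scale: weights 1) -/

section Bridge

variable {S : Type} [Fintype S] [DecidableEq S]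

/-- a diagonal matrix acts as the multiplication operator `B6Expansion282.mulOp`. [folklore] -/
private theorem toLin_diagonal (h : S → ℝ) : Matrix.toLinAlgEquiv' (Matrix.diagonal h) = mulOp h := by
  refine LinearMap.ext fun v => funext fun y => ?_
  rw [Matrix.toLinAlgEquiv'_apply, Matrix.mulVec_diagonal, mulOp_apply]

/-- with unit weights, a matrix acts as the kernel operator `B6Expansion282.kerOp` of its entries. [folklore] -/
private theorem toLin_eq_kerOp {w : S → ℝ} (hw : ∀ z, w z = 1) (A : Matrix S S ℝ) :
    Matrix.toLinAlgEquiv' A = kerOp w (fun y z => A y z) := by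
  refine LinearMap.ext fun v => funext fun y => ?_
  rw [Matrix.toLinAlgEquiv'_apply, kerOp_apply]
  simp only [Matrix.mulVec, dotProduct, hw, one_mul]

/-- the census matrix entry `B6Prop23Chain.mat` of the operator of a matrix is the matrix entry. [folklore] -/
private theorem mat_toLin (B : Matrix S S ℝ) (y y' : S) : mat (Matrix.toLinAlgEquiv' B) y y' = B y y' := by
  unfold mat
  rw [Matrix.toLinAlgEquiv'_apply]
  simp [Matrix.mulVec, dotProduct, Pi.single_apply]

variable {A B D F : Type*} [Ring A] [Ring B] [Fintype D] [FunLike F A B] [RingHomClass F A B] (f : F)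

omit [Fintype D] in
/-- ring homomorphisms map `□X̃_□□` to `□X̃_□□`. [folklore] -/
private theorem map_locOp (p t : D → A) (i : D) : f (locOp p t i) = locOp (fun i => f (p i)) (fun i => f (t i)) i := by
  unfold locOp; simp [map_mul]

/-- ring homomorphisms map the glued `C` of (2.70) to the glued `C`. [folklore] -/
private theorem map_Cglued (h c : D → A) : f (Cglued h c) = Cglued (fun i => f (h i)) (fun i => f (c i)) := by
  unfold Cglued; simp [map_sum, map_mul]

/-- ring homomorphisms map the `R` of (2.82) to the `R` of (2.82). [folklore] -/
private theorem map_R282 [DecidableEq D] (x : A) (p t h c : D → A) :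
    f (R282 x p t h c) = R282 (f x) (fun i => f (p i)) (fun i => f (t i)) (fun i => f (h i)) (fun i => f (c i)) := by
  unfold R282 B6Expansion282.comm locOp
  simp [map_sum, map_mul, map_add, map_sub, map_one]

end Bridge

/-! ## §4  (2.85), (2.86) convergent and (2.87) for the modified prescription -/

/-- `L^p ≤ e^{cRM}` as soon as `R ≥ 1` and `M ≥ p·log L/c` (the largeness thresholds `L⁴ ≤ e^{⅛δ₀RM}` of (2.83) and `L² ≤ e^{¼δ_GRM}` of the
change-of-domain chain). [folklore] -/
private theorem pow_le_exp {L c R M : ℝ} (p : ℕ) (hL : 1 ≤ L) (hc : 0 < c) (hR : 1 ≤ R) (hM0 : 0 ≤ M) (hM : p * Real.log L / c ≤ M) :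
    L ^ p ≤ Real.exp (c * R * M) := by
  have hlog : 0 ≤ Real.log L := Real.log_nonneg hL
  have hRM : M ≤ R * M := le_mul_of_one_le_left hM0 hR
  have h1 : (p : ℝ) * Real.log L ≤ c * M := by have := (div_le_iff₀ hc).mp hM; linarith
  have h2 : (p : ℝ) * Real.log L ≤ c * R * M := by nlinarith [mul_le_mul_of_nonneg_left hRM hc.le]
  have hL0 : 0 < L := lt_of_lt_of_le one_pos hL
  rw [← Real.rpow_natCast, Real.rpow_def_of_pos hL0]
  exact Real.exp_le_exp.mpr (by linarith)

/-- **PROPOSITION 2.3's EXPANSION FOR THE GENUINE ONE-SCALE OPERATOR WITH THE MODIFIED PRESCRIPTION OF (2.70) — (2.85), (2.86) CONVERGENT,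
(2.87).**  For `d ≥ 1`, odd `L > 1`, `a > 0`, `m² ≥ 0` there are `M₀, δ₁, K, B > 0` (functions of `d, L, a, m²`) such that for every member of the
one-scale family (volume `P`, `K ≥ 1`, big-block size `M = i.Mb`, `R = i.R`) and every window exponent `m′` with `ChartHyps i.P i.Mb m′`, `R ≥ 1`,
`M ≥ M₀`, `M ∣ N_K`, `2M ≤ N_K`: the GENUINE operator `X = Q′_KG′_K²Q′_K*`, the local inverses `C_□ = ((Q′G′(□̃)²Q′*)↾□)⁻¹` of the MODIFIED
prescription (with `G′(□̃) = Δ′_a⁻¹` on the torus `T_□̃`) and the resulting `C`, `R` of (2.70)/(2.82) (`CappT`, `RrwT`) satisfy: (2.85)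
`|R(y, y′)| ≤ (K/M)e^{−δ₁|y−y′|₁}`; the row sums of `|R|` are `≤ ½`; **(2.86)** `Σ_n CRⁿ` CONVERGES to `(Q′_KG′_K²Q′_K*)⁻¹` with truncation error
`≤ B·2^{−N}`; and (2.87) `|(Q′G′²Q′*)⁻¹(y, y′)| ≤ Be^{−½δ₁|y−y′|₁}`.  Route = the print's: the cell's `B6Prop23Assembled.prop23_assembled`
((2.82)–(2.87) with every O(·) explicit) with its located inputs ALL DISCHARGED on the genuine objects — including, this time, the
change-of-domain family of (2.82) (`B6DomainInput238Torus.hdom_modified`: `X̃_□ ≠ X`, explicit `B_D`).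
[cite: Balaban1984PropagatorsII, Prop. 2.3 (2.85)–(2.87) p.238, (2.82) p.237, (2.70) p.235] -/
theorem expansion286_modifiedTorus (d L : ℕ) (hd : 1 ≤ d) (hL : Odd L ∧ 1 < L) {a : ℝ} (ha : 0 < a) {msq : ℝ} (hmsq : 0 ≤ msq) :
    ∃ M₀ δ₁ K B : ℝ, 0 < M₀ ∧ 0 < δ₁ ∧ 0 < K ∧ 0 < B ∧
      ∀ (i : Index d L) (m' : ℕ), ChartHyps i.P i.Mb m' → 1 ≤ i.R → M₀ ≤ (i.Mb : ℝ) → i.Mb ∣ i.P.sitesPerDir i.P.K →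
        2 * i.Mb ≤ i.P.sitesPerDir i.P.K →
        (∀ y y', |RrwT i.P i.Mb m' a msq y y'| ≤ K / i.Mb * Real.exp (-(δ₁ * T1 i.P i.P.K y y'))) ∧
        (∀ y, ∑ y', |RrwT i.P i.Mb m' a msq y y'| ≤ 1 / 2) ∧
        HasSum (fun n => CappT i.P i.Mb m' a msq * RrwT i.P i.Mb m' a msq ^ n) (qggqK i.P a msq)⁻¹ ∧
        (∀ N y y', |((qggqK i.P a msq)⁻¹ - ∑ n ∈ Finset.range N, CappT i.P i.Mb m' a msq * RrwT i.P i.Mb m' a msq ^ n) y y'| ≤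
          B * (1 / 2) ^ N) ∧
        (∀ y y', |(qggqK i.P a msq)⁻¹ y y'| ≤ B * Real.exp (-(δ₁ / 2 * T1 i.P i.P.K y y'))) := by
  classical
  -- the uniform analytic inputs: (2.68), (2.81) for the modified C_□, the change of domain
  obtain ⟨δX, CX, hδX, hCX, h268⟩ := ineq268_oneScaleTorus d L hd hL ha hmsq
  obtain ⟨δC, BC, hδC, hBC, h281⟩ := ineq281_modified d L hd hL ha hmsq
  obtain ⟨δG, BD, hδG, hBD, hdomG⟩ := hdom_modified d L hd hL ha hmsq
  -- the constants of the census assembly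
  set δ₀ : ℝ := min (2 * δX) (δG / 12) with hδ₀def
  have hδ₀ : 0 < δ₀ := lt_min (by positivity) (by positivity)
  have hδ₀X : δ₀ ≤ 2 * δX := min_le_left _ _
  have hδ₀G : δ₀ ≤ δG / 12 := min_le_right _ _
  set δ₁ : ℝ := min δC (δ₀ / 8) with hδ₁def
  have hδ₁ : 0 < δ₁ := lt_min hδC (by positivity)
  have hδ₁C : δ₁ ≤ δC := min_le_left _ _
  set σ : ℝ := 1 / 8 with hσ
  set cσ : ℝ := B6.c0 δ₀ σ ^ d with hcσ
  set c : ℝ := B6.c0 δ₁ (1 / 2) ^ d with hcdef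
  have hc : 0 ≤ c := pow_nonneg (B6RandomWalk.c0_nonneg _ _) d
  set c' : ℝ := B6.c0 δ₁ 1 ^ d with hc'def
  have hc' : 0 ≤ c' := pow_nonneg (B6RandomWalk.c0_nonneg _ _) d
  set s : ℝ := 3 * Real.pi / 2 with hsdef
  have hs : 0 ≤ s := by positivity
  set n₀ : ℕ := 2 ^ d with hn₀
  set c₃ : ℝ := δG / 48 with hc₃def
  have hc₃ : 0 < c₃ := by positivity
  set K : ℝ := K285L (L : ℝ) d n₀ s δ₀ cσ c₃ (1 / 3) CX BD BC with hKdef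
  set Bk : ℝ := 2 * (n₀ * (BC * (L : ℝ) ^ (d + 4))) * c with hBkdef
  set M₀ : ℝ := max 1 (max (32 * Real.log L / δ₀) (max (2 * Real.log L / (δG / 4)) (max (2 * K * c) (2 * (K + 1) * c')))) with hM₀def
  have hL1 : (1 : ℝ) ≤ L := by exact_mod_cast hL.2.le
  have hcσ0 : 0 ≤ cσ := pow_nonneg (B6RandomWalk.c0_nonneg _ _) d
  have hKnn : 0 ≤ K := by
    rw [hKdef]; unfold K285L; positivity
  have hBk : 0 ≤ Bk := by rw [hBkdef]; positivity
  refine ⟨M₀, δ₁, K + 1, Bk * c + Bk + 1, lt_of_lt_of_le one_pos (le_max_left _ _), hδ₁, by linarith, by positivity, ?_⟩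
  intro i m' hch hR hM hdiv h2
  -- the member's data
  have hMb1 : (1 : ℝ) ≤ i.Mb := le_trans (le_max_left _ _) hM
  have hMb : 1 ≤ i.Mb := by exact_mod_cast hMb1
  have hMpos : (0 : ℝ) < i.Mb := by positivity
  have hMlog4 : 32 * Real.log L / δ₀ ≤ i.Mb := le_trans (le_trans (le_max_left _ _) (le_max_right _ _)) hM
  have hMlog2 : 2 * Real.log L / (δG / 4) ≤ i.Mb :=
    le_trans (le_trans (le_trans (le_max_left _ _) (le_max_right _ _)) (le_max_right _ _)) hM
  have hMKc : 2 * K * c ≤ i.Mb :=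
    le_trans (le_trans (le_trans (le_trans (le_max_left _ _) (le_max_right _ _)) (le_max_right _ _)) (le_max_right _ _)) hM
  have hMKc' : 2 * (K + 1) * c' ≤ i.Mb :=
    le_trans (le_trans (le_trans (le_trans (le_max_right _ _) (le_max_right _ _)) (le_max_right _ _)) (le_max_right _ _)) hM
  set g := oneScaleGeo i.P i.Mb i.R with hgdef
  have htri := triangle254_oneScaleGeo i.P i.Mb i.R
  have hrefl : ∀ y : g.Site, g.dist y y = 0 := T1_self i.P i.P.K
  have hdnn : ∀ y y' : g.Site, 0 ≤ g.dist y y' := T1_nonneg i.P i.P.K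
  have hsep : B6Ineq268.LevelSep g := by
    intro y y'
    show (i.R : ℝ) * (i.Mb : ℝ) * B6Ineq268.mx g y y' ≤ T1 i.P i.P.K y y'
    have hmx : B6Ineq268.mx g y y' = 0 := by
      unfold B6Ineq268.mx
      show max (|((i.P.K : ℕ) : ℝ) - ((i.P.K : ℕ) : ℝ)| - 1) 0 = 0
      rw [sub_self, abs_zero, zero_sub]; exact max_eq_right (by norm_num)
    rw [hmx, mul_zero]; exact T1_nonneg i.P i.P.K y y'
  have hgL : 1 ≤ g.L := by show (1 : ℝ) ≤ (i.P.L : ℝ); exact_mod_cast i.P.hL.2.le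
  have hgη : 0 < g.eta := i.P.eps_pos
  have hgM : 0 < g.M := by show (0 : ℝ) < (i.Mb : ℝ); exact hMpos
  have hRM : 0 ≤ g.R * g.M := by show (0 : ℝ) ≤ (i.R : ℝ) * (i.Mb : ℝ); positivity
  have hsplit : δ₁ + σ * δ₀ ≤ δ₀ / 4 := by
    have := min_le_right δC (δ₀ / 8); rw [hσ]; linarith
  have h261σ : Ineq261With cσ g δ₀ σ := by
    intro y
    have h := sum_exp_T1_le i.P i.P.K (show 0 < σ * δ₀ by positivity) y
    rw [i.hPd] at h
    exact h
  have hR1 : (1 : ℝ) ≤ i.R := by exact_mod_cast hR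
  have hthr : g.L ^ 4 ≤ Real.exp (1 / 8 * δ₀ * g.R * g.M) := by
    show ((i.P.L : ℕ) : ℝ) ^ 4 ≤ Real.exp (1 / 8 * δ₀ * (i.R : ℝ) * (i.Mb : ℝ))
    rw [i.hPL]
    have h := pow_le_exp (c := 1 / 8 * δ₀) 4 hL1 (by positivity) hR1 hMpos.le
      (by rw [show ((4 : ℕ) : ℝ) * Real.log L / (1 / 8 * δ₀) = 32 * Real.log L / δ₀ by push_cast; field_simp; ring]; exact hMlog4)
    simpa only [mul_assoc] using h
  have hsizeG : (i.P.L : ℝ) ^ 2 * Real.exp (-(δG / 4 * ((i.R : ℝ) * (i.Mb : ℝ)))) ≤ 1 := by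
    have h := pow_le_exp (c := δG / 4) 2 hL1 (by positivity) hR1 hMpos.le (by push_cast; exact hMlog2)
    rw [show ((i.P.L : ℕ) : ℝ) = (L : ℝ) by rw [i.hPL], Real.exp_neg]
    have hpos := Real.exp_pos (δG / 4 * ((i.R : ℝ) * (i.Mb : ℝ)))
    rw [mul_inv_le_iff₀ hpos, one_mul, show δG / 4 * ((i.R : ℝ) * (i.Mb : ℝ)) = δG / 4 * (i.R : ℝ) * (i.Mb : ℝ) by ring]
    exact h
  have h261 : Ineq261With c g δ₁ (1 / 2) := by
    intro y
    have h := sum_exp_T1_le i.P i.P.K (show 0 < 1 / 2 * δ₁ by positivity) y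
    rw [i.hPd] at h
    exact h
  have h263 : Ineq263With c g δ₁ (1 / 2) := ineq263With_of_261With htri hδ₁.le (by norm_num) h261
  -- the cover
  have hover : ∀ y : g.Site, (Finset.univ.filter fun k : CIdx i.P i.P.K i.Mb => hcov i.P i.P.K i.Mb k y ≠ 0).card ≤ n₀ := by
    intro y
    have h := card_filter_hcov_ne_zero_le hMb hdiv h2 y
    exact h.trans (le_of_eq (by rw [i.hPd]))
  have hpf01 : ∀ (k : CIdx i.P i.P.K i.Mb) (y : g.Site), cubeInd i.P i.P.K i.Mb k y = 0 ∨ cubeInd i.P i.P.K i.Mb k y = 1 :=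
    fun k y => cubeInd_zero_or_one k y
  have hph : ∀ (k : CIdx i.P i.P.K i.Mb) (y : g.Site), cubeInd i.P i.P.K i.Mb k y * hcov i.P i.P.K i.Mb k y = hcov i.P i.P.K i.Mb k y :=
    fun k y => cubeInd_mul_hcov hMb k y
  have h236 : ∀ y : g.Site, ∑ k : CIdx i.P i.P.K i.Mb, hcov i.P i.P.K i.Mb k y ^ 2 = 1 := fun y => sum_hcov_sq hMb hdiv h2 y
  have hLip : ∀ (k : CIdx i.P i.P.K i.Mb) (y y'' : g.Site),
      |hcov i.P i.P.K i.Mb k y - hcov i.P i.P.K i.Mb k y''| ≤ s / g.M * g.dist y y'' :=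
    fun k y y'' => abs_hcov_sub_le hMb k y y''
  have hcube : ∀ (k : CIdx i.P i.P.K i.Mb) (y : g.Site), cubeInd i.P i.P.K i.Mb k y ≠ 0 →
      (fun _ : CIdx i.P i.P.K i.Mb => i.P.K) k ≤ g.scale y ∧ g.scale y ≤ (fun _ : CIdx i.P i.P.K i.Mb => i.P.K) k + 1 :=
    fun k y _ => ⟨le_rfl, Nat.le_succ _⟩
  have hlev : ∀ (k : CIdx i.P i.P.K i.Mb) (y y' : g.Site), hcov i.P i.P.K i.Mb k y ≠ 0 → hcov i.P i.P.K i.Mb k y' ≠ 0 →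
      g.scale y = g.scale y' := fun _ _ _ _ _ => rfl
  have hgap : ∀ (k : CIdx i.P i.P.K i.Mb) (y y'' : g.Site), cubeInd i.P i.P.K i.Mb k y = 0 → hcov i.P i.P.K i.Mb k y'' ≠ 0 →
      1 / 3 * g.M ≤ g.dist y y'' := by
    intro k y y'' hy hy''
    have h := gap_of_cubeInd_eq_zero hMb hy hy''
    show 1 / 3 * (i.Mb : ℝ) ≤ T1 i.P i.P.K y y''
    linarith
  -- the kernels: X = Q′G′²Q′*, X̃_□ = (Q′G′(□̃)²Q′*)↾□, C_□ = ClocT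
  have hlen : ∀ z : g.Site, g.len z = 1 := fun z => oneScaleGeo_len i.P i.Mb i.R z
  have hw : ∀ z : g.Site, g.len z ^ d = 1 := fun z => by rw [hlen, one_pow]
  have hrate : ∀ y y'' : g.Site, Real.exp (-(δX * T1 i.P i.P.K y y'')) ≤ Real.exp (-(1 / 2 * δ₀ * g.dist y y'')) := by
    intro y y''
    refine Real.exp_le_exp.mpr (neg_le_neg (mul_le_mul_of_nonneg_right (by linarith) (T1_nonneg i.P i.P.K y y'')))
  have hX : ∀ y y'' : g.Site, |g.len y'' ^ d * qggqK i.P a msq y y''| ≤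
      CX * g.len y ^ 4 * Real.exp (-(1 / 2 * δ₀ * g.dist y y'')) := by
    intro y y''
    rw [hw y'', hlen y, one_mul, one_pow, mul_one]
    exact (h268 i y y'').trans (mul_le_mul_of_nonneg_left (hrate y y'') hCX.le)
  have hXw : ∀ (k : CIdx i.P i.P.K i.Mb) (y y'' : g.Site), |g.len y'' ^ d * Xloc i.P i.Mb m' a msq k y y''| ≤
      CX * g.len y ^ 4 * Real.exp (-(1 / 2 * δ₀ * g.dist y y'')) := by
    intro k y y''
    rw [hw y'', hlen y, one_mul, one_pow, mul_one]
    exact (abs_Xloc_le hCX.le hδX.le h268 i hch k y y'').trans (mul_le_mul_of_nonneg_left (hrate y y'') hCX.le)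
  have hdom : ∀ (k : CIdx i.P i.P.K i.Mb) (y y'' : g.Site),
      |cubeInd i.P i.P.K i.Mb k y * (g.len y'' ^ d * (Xloc i.P i.Mb m' a msq k y y'' - qggqK i.P a msq y y'')) * hcov i.P i.P.K i.Mb k y''| ≤
        BD * Real.exp (-(c₃ * g.M)) * g.len y ^ 4 * Real.exp (-(1 / 2 * δ₀ * g.dist y y'')) := by
    intro k y y''
    refine (hdomG i m' hch hsizeG k y y'').trans ?_
    show BD * Real.exp (-(δG / 48 * (i.Mb : ℝ))) * g.len y ^ 4 * Real.exp (-(1 / 2 * (δG / 12) * T1 i.P i.P.K y y'')) ≤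
      BD * Real.exp (-(c₃ * (i.Mb : ℝ))) * g.len y ^ 4 * Real.exp (-(1 / 2 * δ₀ * T1 i.P i.P.K y y''))
    rw [hc₃def]
    refine mul_le_mul_of_nonneg_left (Real.exp_le_exp.mpr (neg_le_neg (mul_le_mul_of_nonneg_right (by linarith)
      (T1_nonneg i.P i.P.K y y'')))) ?_
    rw [hlen]; positivity
  have hspK : g.L ^ i.P.K * g.eta = 1 := i.P.spacing_K
  have h281' : ∀ (k : CIdx i.P i.P.K i.Mb) (y y' : g.Site), cubeInd i.P i.P.K i.Mb k y ≠ 0 → cubeInd i.P i.P.K i.Mb k y' ≠ 0 →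
      |ClocT i.P i.Mb m' a msq k y y'| ≤ BC / (g.L ^ ((fun _ : CIdx i.P i.P.K i.Mb => i.P.K) k) * g.eta) ^ (d + 4) *
        Real.exp (-(δ₁ * g.dist y y')) := by
    intro k y y' _ _
    simp only [hspK, one_pow, div_one]
    refine (h281 i i.Mb m' hch k y y').trans (mul_le_mul_of_nonneg_left ?_ hBC.le)
    exact Real.exp_le_exp.mpr (neg_le_neg (mul_le_mul_of_nonneg_right hδ₁C (T1_nonneg i.P i.P.K y y')))
  have hCk0 : ∀ (k : CIdx i.P i.P.K i.Mb) (y'' y' : g.Site), cubeInd i.P i.P.K i.Mb k y'' = 0 → ClocT i.P i.Mb m' a msq k y'' y' = 0 := by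
    intro k y'' y' h
    exact ClocT_eq_zero_left (fun hin => by rw [cubeInd_eq_one hin] at h; exact one_ne_zero h) y'
  -- the dictionary operators ↔ matrices
  set f : Matrix (Site i.P i.P.K) (Site i.P i.P.K) ℝ ≃ₐ[ℝ] Module.End ℝ (Site i.P i.P.K → ℝ) := Matrix.toLinAlgEquiv' with hfdef
  have fX : kerOp (fun z => g.len z ^ d) (fun y y'' => qggqK i.P a msq y y'') = f (qggqK i.P a msq) :=
    (toLin_eq_kerOp hw _).symm
  have fP : ∀ k, mulOp (cubeInd i.P i.P.K i.Mb k) = f (Pmat i.P i.Mb k) := fun k => (toLin_diagonal _).symm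
  have fH : ∀ k, mulOp (hcov i.P i.P.K i.Mb k) = f (Hmat i.P i.Mb k) := fun k => (toLin_diagonal _).symm
  have fC : ∀ k, kerOp (fun z => g.len z ^ d) (ClocT i.P i.Mb m' a msq k) = f (ClocTMat i.P i.Mb m' a msq k) := fun k => by
    rw [ClocTMat, toLin_eq_kerOp hw]; rfl
  have fXw : ∀ k, kerOp (fun z => g.len z ^ d) (Xloc i.P i.Mb m' a msq k) = f (XlocMat i.P i.Mb m' a msq k) := fun k => by
    rw [XlocMat, toLin_eq_kerOp hw]; rfl
  have eP : (fun k => mulOp (cubeInd i.P i.P.K i.Mb k)) = fun k => f (Pmat i.P i.Mb k) := funext fP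
  have eH : (fun k => mulOp (hcov i.P i.P.K i.Mb k)) = fun k => f (Hmat i.P i.Mb k) := funext fH
  have eC : (fun k => kerOp (fun z => g.len z ^ d) (ClocT i.P i.Mb m' a msq k)) = fun k => f (ClocTMat i.P i.Mb m' a msq k) := funext fC
  have eXw : (fun k => kerOp (fun z => g.len z ^ d) (Xloc i.P i.Mb m' a msq k)) = fun k => f (XlocMat i.P i.Mb m' a msq k) := funext fXw
  have h270 : ∀ k : CIdx i.P i.P.K i.Mb,
      locOp (fun k => mulOp (cubeInd i.P i.P.K i.Mb k)) (fun k => kerOp (fun z => g.len z ^ d) (Xloc i.P i.Mb m' a msq k)) k *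
          kerOp (fun z => g.len z ^ d) (ClocT i.P i.Mb m' a msq k) * mulOp (hcov i.P i.P.K i.Mb k) =
        mulOp (hcov i.P i.P.K i.Mb k) := by
    intro k
    rw [eP, eXw, fC k, fH k, ← map_locOp f, ← map_mul, ← map_mul, locOp_mul_ClocTMat_mul_Hmat hch ha hmsq i.hK k]
  have hRop : R282 (kerOp (fun z => g.len z ^ d) fun y y'' => qggqK i.P a msq y y'') (fun k => mulOp (cubeInd i.P i.P.K i.Mb k))
      (fun k => kerOp (fun z => g.len z ^ d) (Xloc i.P i.Mb m' a msq k)) (fun k => mulOp (hcov i.P i.P.K i.Mb k))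
      (fun k => kerOp (fun z => g.len z ^ d) (ClocT i.P i.Mb m' a msq k)) = f (RrwT i.P i.Mb m' a msq) := by
    rw [eP, eXw, eH, eC, fX, RrwT, map_R282 f]
  have hCop : Cglued (fun k => mulOp (hcov i.P i.P.K i.Mb k)) (fun k => kerOp (fun z => g.len z ^ d) (ClocT i.P i.Mb m' a msq k)) =
      f (CappT i.P i.Mb m' a msq) := by
    rw [eH, eC, CappT, map_Cglued f]
  -- (2.85) for the genuine R
  have hK285 : K285 g d n₀ s δ₀ cσ c₃ (1 / 3) CX BD BC = K := by
    rw [hKdef, hgdef, K285_oneScaleGeo, i.hPL]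
  have h285 : ∀ y y', |RrwT i.P i.Mb m' a msq y y'| ≤ K / i.Mb * Real.exp (-(δ₁ * T1 i.P i.P.K y y')) := by
    intro y y'
    have h := mat_R_abs_le htri hdnn hsep hgL hgη hgM hRM hδ₀ hδ₁.le hsplit h261σ hthr hs hCX.le hBD hBC.le d
      hover hpf01 hph (fun k y => abs_hcov_le_one k y) hLip hcube hlev hgap hX hXw hdom h281' hCk0 y y'
    have e : mat (f (RrwT i.P i.Mb m' a msq)) y y' = RrwT i.P i.Mb m' a msq y y' := by rw [hfdef, mat_toLin]
    rw [← e, ← hRop]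
    refine h.trans (mul_le_mul_of_nonneg_right ?_ (Real.exp_pos _).le)
    have hθ := theta285_le hgM (d := d) (n₀ := n₀) (s := s) hδ₀ hc₃ (by norm_num : (0 : ℝ) < 1 / 3) hcσ0 hCX.le hBD hBC.le
      (le_trans zero_le_one hgL)
    rw [hK285] at hθ
    exact hθ
  have h285' : ∀ y y', |RrwT i.P i.Mb m' a msq y y'| ≤ (K + 1) / i.Mb * Real.exp (-(δ₁ * T1 i.P i.P.K y y')) := fun y y' =>
    (h285 y y').trans (mul_le_mul_of_nonneg_right (div_le_div_of_nonneg_right (by linarith) hMpos.le) (Real.exp_pos _).le)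
  -- the row sums of |R| are ≤ ½ (M ≥ 2(K+1)c′)
  have hrow : ∀ y, ∑ y', |RrwT i.P i.Mb m' a msq y y'| ≤ 1 / 2 := by
    intro y
    have hsum : ∑ y', Real.exp (-(δ₁ * T1 i.P i.P.K y y')) ≤ c' := by
      have h := sum_exp_T1_le i.P i.P.K (show 0 < 1 * δ₁ by simpa using hδ₁) y
      rw [i.hPd] at h
      simpa only [one_mul] using h
    calc ∑ y', |RrwT i.P i.Mb m' a msq y y'| ≤ ∑ y', (K + 1) / i.Mb * Real.exp (-(δ₁ * T1 i.P i.P.K y y')) :=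
          Finset.sum_le_sum fun y' _ => h285' y y'
      _ = (K + 1) / i.Mb * ∑ y', Real.exp (-(δ₁ * T1 i.P i.P.K y y')) := by rw [Finset.mul_sum]
      _ ≤ (K + 1) / i.Mb * c' := mul_le_mul_of_nonneg_left hsum (by positivity)
      _ ≤ 1 / 2 := by
          rw [div_mul_eq_mul_div, div_le_iff₀ hMpos]; linarith
  -- Proposition 2.3 assembled: the inverse and (2.87)
  have hKM : 2 * K285 g d n₀ s δ₀ cσ c₃ (1 / 3) CX BD BC * c ≤ g.M := by
    rw [hK285]
    show 2 * K * c ≤ (i.Mb : ℝ)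
    exact hMKc
  obtain ⟨G, hGX, -, -, huniq, hb⟩ := prop23_assembled d htri hrefl hdnn hsep hgL hgη hgM hRM hδ₀ hδ₁.le hsplit h261σ hthr
    h261 h263 hc hc₃ hs (by norm_num : (0 : ℝ) < 1 / 3) hCX.le hBD hBC.le hover hpf01 hph h236 hLip hcube hlev hgap hX
    hXw hdom h281' hCk0 h270 hKM
  have hGeq : G = f ((qggqK i.P a msq)⁻¹) := by
    refine (huniq (f ((qggqK i.P a msq)⁻¹)) ?_).symm
    rw [fX, ← map_mul, cinvK_mul i.P ha hmsq i.hK, map_one]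
  have h287 : ∀ y y', |(qggqK i.P a msq)⁻¹ y y'| ≤ Bk * Real.exp (-(δ₁ / 2 * T1 i.P i.P.K y y')) := by
    intro y y'
    have h := hb y y'
    rw [hGeq, hfdef, mat_toLin, hw y', hlen y, hlen y', div_one, Real.one_rpow, Real.one_rpow, mul_one, mul_one] at h
    refine h.trans (le_of_eq ?_)
    show 2 * (n₀ * (BC * g.L ^ (d + 4))) * c * Real.exp (-(δ₁ / 2 * T1 i.P i.P.K y y')) = Bk * Real.exp (-(δ₁ / 2 * T1 i.P i.P.K y y'))
    rw [hBkdef, show g.L = ((i.P.L : ℕ) : ℝ) from rfl, i.hPL]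
  -- the Neumann series (2.86)
  have hGrow : ∀ y, ∑ y', |(qggqK i.P a msq)⁻¹ y y'| ≤ Bk * c := by
    intro y
    have hsum : ∑ y', Real.exp (-(δ₁ / 2 * T1 i.P i.P.K y y')) ≤ c := by
      have h := h261 y
      refine le_trans (le_of_eq (Finset.sum_congr rfl fun y' _ => ?_)) h
      show Real.exp (-(δ₁ / 2 * T1 i.P i.P.K y y')) = Real.exp (-(1 / 2 * δ₁ * T1 i.P i.P.K y y'))
      ring_nf
    calc ∑ y', |(qggqK i.P a msq)⁻¹ y y'| ≤ ∑ y', Bk * Real.exp (-(δ₁ / 2 * T1 i.P i.P.K y y')) :=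
          Finset.sum_le_sum fun y' _ => h287 y y'
      _ = Bk * ∑ y', Real.exp (-(δ₁ / 2 * T1 i.P i.P.K y y')) := by rw [Finset.mul_sum]
      _ ≤ Bk * c := mul_le_mul_of_nonneg_left hsum hBk
  obtain ⟨hsum286, htrunc⟩ := hasSum_neumann (RrwT i.P i.Mb m' a msq) (CappT i.P i.Mb m' a msq) ((qggqK i.P a msq)⁻¹)
    (mul_nonneg hBk hc) hrow hGrow (inv_eq_CappT_add hch ha hmsq i.hK hdiv h2)
  refine ⟨h285', hrow, hsum286, fun N y y' => (htrunc N y y').trans ?_, fun y y' => (h287 y y').trans ?_⟩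
  · exact mul_le_mul_of_nonneg_right (by linarith only [hBk]) (by positivity)
  · have hBc := mul_nonneg hBk hc
    exact mul_le_mul_of_nonneg_right (by linarith only [hBc]) (Real.exp_pos _).le

/-- **NON-VACUITY: admissible members exist** for every `K ≥ 1` and every threshold `M₀`: take `M = L^{m″}` with `L^{m″} ≥ max(M₀, 2)`,
the window exponent `m′ = m″ + 2` (so `H = L²M ≥ 9M ≥ 5M + 5`) and the volume exponent `m = m′ + 1` (so `M ∣ N_K = 2L^m`, `2M ≤ N_K`,
`m′ ≤ m`), `R = 1`. [cite: Balaban1984PropagatorsII, (2.1)–(2.2) p.224, p.235; bookkeeping] -/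
theorem members_exist_modified (d L : ℕ) (hd : 1 ≤ d) (hL : Odd L ∧ 1 < L) (K : ℕ) (hK : 1 ≤ K) (M₀ : ℝ) :
    ∃ (i : Index d L) (m' : ℕ), i.P.K = K ∧ ChartHyps i.P i.Mb m' ∧ 1 ≤ i.R ∧ M₀ ≤ (i.Mb : ℝ) ∧
      i.Mb ∣ i.P.sitesPerDir i.P.K ∧ 2 * i.Mb ≤ i.P.sitesPerDir i.P.K := by
  have hL3 : 3 ≤ L := by
    obtain ⟨hodd, h1⟩ := hL
    rcases hodd with ⟨r, hr⟩
    omega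
  obtain ⟨m'', hm''⟩ : ∃ m'' : ℕ, max M₀ 2 ≤ ((L ^ m'' : ℕ) : ℝ) := by
    obtain ⟨n, hn⟩ := exists_nat_ge (max M₀ 2)
    refine ⟨n, hn.trans ?_⟩
    exact_mod_cast (Nat.lt_pow_self hL.2 (n := n)).le
  have hM2 : 2 ≤ L ^ m'' := by
    have : (2 : ℝ) ≤ ((L ^ m'' : ℕ) : ℝ) := (le_max_right _ _).trans hm''
    exact_mod_cast this
  let P : Params := ⟨d, L, m'' + 3, K, hd, hL⟩
  have hcov := B6CoverTorus.cover_hyps_pow (P := P) (j := K) (m' := m'') (by show m'' + 1 ≤ m'' + 3 + K - K; omega)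
  refine ⟨⟨⟨P, rfl, rfl, hK⟩, L ^ m'', 1⟩, m'' + 2, rfl, ⟨hM2, ?_, by show m'' + 2 ≤ m'' + 3; omega⟩, le_rfl, (le_max_left _ _).trans hm'',
    hcov.2.1, hcov.2.2⟩
  show 5 * L ^ m'' + 5 ≤ L ^ (m'' + 2)
  have h9 : 9 * L ^ m'' ≤ L ^ (m'' + 2) := by
    rw [pow_add]
    have : 9 ≤ L ^ 2 := by nlinarith
    nlinarith [Nat.one_le_pow m'' L (by omega)]
  have h1 : 1 ≤ L ^ m'' := Nat.one_le_pow m'' L (by omega)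
  omega

end

end Literature.MathematicalPhysics.QuantumFieldTheory.Balaban1983to89.B6Expansion286ModifiedTorus
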